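import Mathlib
import HarnessLib
import Summits.CriticalPhenomena.PercolationContinuityZ3.Theorems.PercLowPointHalfSpaceBoundaryTwoArmDecayStubCensus

/-!
# Crux `PercLowPointHalfSpace.BoundaryTwoArmDecay` (stmt-CriticalPhenomena-0911), line
# `staircase-bootstrap-floor-decoupling` — stub `stub_inverseMultiplicityCensus`: the INVERSE-MULTIPLICITY CENSUS

Proves EXACTLY the registered stub `stub_inverseMultiplicityCensus` of the skeleton
`Cruxes/BoundaryTwoArmDecay/Lines/staircase_bootstrap_floor_decoupling.lean`; lands with
`--supports stmt-CriticalPhenomena-0911`. Definition-free; the objects (`cl`, `fl`, `tall`, `PK`, `eD`, `kap`)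
are those of `PercLowPointHalfSpaceBoundaryTwoArmDecayStubCensusDefs.lean`.

## Statement

At `p_c = p_c(ℤ³)`, with `ℍ = {0 ≤ x₀}`, `U = C_ℍ(0)`, `e = (0,1,0)`, `A_n = {U n-tall, C_ℍ(e) n-tall, 0 ↮_ℍ e}`,
`PK` the partner-kiss edges of `U` (floor edges `(q₁,q₂)`, `q₁ ∈ U ∌ q₂`, `C_ℍ(q₂)` n-tall), `K_n = |PK|` and
`e_n = E[1{height U = n}/|U ∩ ∂ℍ|]`:

  `∫_{A_n} (max 1 K_n)⁻¹ dP ≤ 2 e_n / p_c³`  for all `n`.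

This is the landed TRUNCATED census `P(A_n ∩ {K_n ≤ k}) ≤ 2 k e_n / p_c³` (`StubCensus.census_ennreal`) with the
truncation `1{K_n ≤ k}` replaced by the inverse multiplicity `1/K_n`.

## Proof

The ROOT TRANSPORT of `PercLowPointHalfSpaceBoundaryTwoArmDecayStubCensusRootTransport.lean`, run with the
INVERSE-MULTIPLICITY WEIGHT `ψ(a) = 1{C_ℍ(a) n-tall} · #(PK-edges of C_ℍ(a) at a) · |PK(C_ℍ(a))|⁻¹` in place of
the truncated partner count:
* `lintegral_rootTransport` — for ANY measurable, horizontally covariant weight `W`, transporting the mass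
  `W(a)/|C_ℍ(a) ∩ ∂ℍ|` from the root `a` to every floor point of its cluster and applying the floor mass-transport
  principle (`stub_census_floorMTP`) gives `∫ W(0) dP = ∫ |U ∩ ∂ℍ|⁻¹ Σ_{a ∈ U ∩ ∂ℍ} W(a) dP` (on the BGN event
  `ae_good`, `1 ≤ |U ∩ ∂ℍ| < ∞`);
* `tsum_invMultWeight_le` — by root invariance `Σ_{a ∈ U ∩ ∂ℍ} ψ(a) = 1{U n-tall} |PK| |PK|⁻¹ ≤ 1{U n-tall, PK ≠ ∅}`,
  so `∫ ψ(0) dP ≤ κ_n` (`lintegral_invMultWeight_le_kap`);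
* on `A_n` the floor edge `(0, e)` is a partner-kiss edge at the root and `PK` is finite (`PK_finite`), so
  `(max 1 K_n)⁻¹ = |PK|⁻¹ ≤ ψ(0)` a.e.; hence `∫_{A_n} (max 1 K_n)⁻¹ dP ≤ κ_n ≤ X_n / p_c³ ≤ 2 e_n / p_c³`
  (`kap_le_X`, `X_le_two_eD`).

Sources: R. Lyons – Y. Peres, *Probability on Trees and Networks* (2016), §8.2 (mass transport); G. Grimmett,
*Percolation* (1999), Thm. (7.35) (BGN), §1.4 (`0 < p_c < 1`).
-/

noncomputable section

namespace Summit.CriticalPhenomena.PercolationContinuityZ3.Theorems.BoundaryTwoArmDecay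

open MeasureTheory Filter Topology
open Literature.Probability.Percolation Literature.Probability.LatticeModels
open scoped ENNReal

namespace StubCensus

open LowPoint (conn_symm conn_trans conn_refl conn_mono conn_iff_mem_cluster lintegral_shift)
open Negative (μ)

/-! ### The root transport of a weight `W` -/

/-- The root transport `(ω, a, b) ↦ 1{a, b ∈ ∂ℍ, b ∈ C_ℍ(a)} W(a) / |C_ℍ(a) ∩ ∂ℍ|` of a measurable weight `W` is
measurable. -/
theorem measurable_rootTransport (W : Site 3 → BondConfig (Site 3) → ℝ≥0∞) (hW : ∀ a, Measurable (W a))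
    (a b : Site 3) : Measurable fun ω : BondConfig (Site 3) =>
      {ω' : BondConfig (Site 3) | a 0 = 0 ∧ b 0 = 0 ∧ b ∈ cl (halfSpace 3) a ω'}.indicator
        (fun ω' => W a ω' * (((fl (halfSpace 3) 0 a ω' : ℕ∞) : ℝ≥0∞))⁻¹) ω := by
  have hset : {ω' : BondConfig (Site 3) | a 0 = 0 ∧ b 0 = 0 ∧ b ∈ cl (halfSpace 3) a ω'} =
      {_ω | a 0 = 0 ∧ b 0 = 0} ∩ {ω' | b ∈ cl (halfSpace 3) a ω'} := by
    ext ω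
    simp only [Set.mem_setOf_eq, Set.mem_inter_iff]
    tauto
  rw [hset]
  exact ((hW a).mul (measurable_fl_inv _ _ _)).indicator
    ((MeasurableSet.const _).inter (measurableSet_mem_cl _ a b))

/-- The root transport of a horizontally covariant weight is diagonally invariant under horizontal shifts. -/
theorem rootTransport_shift (W : Site 3 → BondConfig (Site 3) → ℝ≥0∞)
    (hW : ∀ (ω : BondConfig (Site 3)) (a v : Site 3), v 0 = 0 →
      W (a + v) (BondConfig.relabel (sym2Equiv (Site.shift v)) ω) = W a ω)
    (ω : BondConfig (Site 3)) (a b v : Site 3) (hv : v 0 = 0) :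
    {ω' : BondConfig (Site 3) | (a + v) 0 = 0 ∧ (b + v) 0 = 0 ∧ b + v ∈ cl (halfSpace 3) (a + v) ω'}.indicator
        (fun ω' => W (a + v) ω' * (((fl (halfSpace 3) 0 (a + v) ω' : ℕ∞) : ℝ≥0∞))⁻¹)
        (BondConfig.relabel (sym2Equiv (Site.shift v)) ω) =
      {ω' : BondConfig (Site 3) | a 0 = 0 ∧ b 0 = 0 ∧ b ∈ cl (halfSpace 3) a ω'}.indicator
        (fun ω' => W a ω' * (((fl (halfSpace 3) 0 a ω' : ℕ∞) : ℝ≥0∞))⁻¹) ω := by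
  have hmem : BondConfig.relabel (sym2Equiv (Site.shift v)) ω ∈ {ω' : BondConfig (Site 3) | (a + v) 0 = 0 ∧
      (b + v) 0 = 0 ∧ b + v ∈ cl (halfSpace 3) (a + v) ω'} ↔
      ω ∈ {ω' : BondConfig (Site 3) | a 0 = 0 ∧ b 0 = 0 ∧ b ∈ cl (halfSpace 3) a ω'} := by
    simp only [Set.mem_setOf_eq, Pi.add_apply, hv, add_zero, mem_cl_shift_iff (add_mem_halfSpace_iff hv)]
  by_cases h : ω ∈ {ω' : BondConfig (Site 3) | a 0 = 0 ∧ b 0 = 0 ∧ b ∈ cl (halfSpace 3) a ω'}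
  · rw [Set.indicator_of_mem (hmem.2 h), Set.indicator_of_mem h, hW ω a v hv,
      fl_shift hv (add_mem_halfSpace_iff hv)]
  · rw [Set.indicator_of_notMem (fun h' => h (hmem.1 h')), Set.indicator_of_notMem h]

/-- **Out-mass** of the root transport of `W`: `Σ_{b ∈ ∂ℍ} F(ω, 0, b) = W(0) |U ∩ ∂ℍ|⁻¹ |U ∩ ∂ℍ|`. -/
theorem tsum_rootTransport_left (W : Site 3 → BondConfig (Site 3) → ℝ≥0∞) (ω : BondConfig (Site 3)) :
    ∑' b, {b : Site 3 | b 0 = 0}.indicator (fun b => {ω' : BondConfig (Site 3) | (0 : Site 3) 0 = 0 ∧ b 0 = 0 ∧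
        b ∈ cl (halfSpace 3) 0 ω'}.indicator (fun ω' => W 0 ω' * (((fl (halfSpace 3) 0 0 ω' : ℕ∞) : ℝ≥0∞))⁻¹) ω) b =
      W 0 ω * ((((fl (halfSpace 3) 0 0 ω : ℕ∞) : ℝ≥0∞))⁻¹ * ((fl (halfSpace 3) 0 0 ω : ℕ∞) : ℝ≥0∞)) := by
  set c : ℝ≥0∞ := W 0 ω * (((fl (halfSpace 3) 0 0 ω : ℕ∞) : ℝ≥0∞))⁻¹ with hc
  have hterm : ∀ b, {b : Site 3 | b 0 = 0}.indicator (fun b => {ω' : BondConfig (Site 3) | (0 : Site 3) 0 = 0 ∧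
      b 0 = 0 ∧ b ∈ cl (halfSpace 3) 0 ω'}.indicator
        (fun ω' => W 0 ω' * (((fl (halfSpace 3) 0 0 ω' : ℕ∞) : ℝ≥0∞))⁻¹) ω) b =
      (cl (halfSpace 3) 0 ω ∩ {u | u 0 = 0}).indicator (fun _ => c) b := by
    intro b
    by_cases hb0 : b 0 = 0
    · rw [Set.indicator_of_mem (show b ∈ {b : Site 3 | b 0 = 0} from hb0)]
      by_cases hb : b ∈ cl (halfSpace 3) 0 ω
      · rw [Set.indicator_of_mem (show ω ∈ {ω' : BondConfig (Site 3) | (0 : Site 3) 0 = 0 ∧ b 0 = 0 ∧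
            b ∈ cl (halfSpace 3) 0 ω'} from ⟨rfl, hb0, hb⟩), Set.indicator_of_mem (show b ∈ cl (halfSpace 3) 0 ω ∩
            {u | u 0 = 0} from ⟨hb, hb0⟩)]
      · rw [Set.indicator_of_notMem (show ω ∉ {ω' : BondConfig (Site 3) | (0 : Site 3) 0 = 0 ∧ b 0 = 0 ∧
            b ∈ cl (halfSpace 3) 0 ω'} from fun h => hb h.2.2), Set.indicator_of_notMem (show b ∉ cl (halfSpace 3) 0 ω ∩
            {u | u 0 = 0} from fun h => hb h.1)]
    · rw [Set.indicator_of_notMem (show b ∉ {b : Site 3 | b 0 = 0} from hb0),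
        Set.indicator_of_notMem (show b ∉ cl (halfSpace 3) 0 ω ∩ {u | u 0 = 0} from fun h => hb0 h.2)]
  rw [tsum_congr hterm, ← tsum_subtype, ENNReal.tsum_set_const,
    show (cl (halfSpace 3) 0 ω ∩ {u | u 0 = 0}).encard = fl (halfSpace 3) 0 0 ω from rfl, hc]
  ring

/-- **In-mass** of the root transport of `W`: `Σ_{a ∈ ∂ℍ} F(ω, a, 0) = |U ∩ ∂ℍ|⁻¹ Σ_{a ∈ U ∩ ∂ℍ} W(a)` (root
invariance of the floor slice). -/
theorem tsum_rootTransport_right (W : Site 3 → BondConfig (Site 3) → ℝ≥0∞) (ω : BondConfig (Site 3)) :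
    ∑' a, {a : Site 3 | a 0 = 0}.indicator (fun a => {ω' : BondConfig (Site 3) | a 0 = 0 ∧ (0 : Site 3) 0 = 0 ∧
        (0 : Site 3) ∈ cl (halfSpace 3) a ω'}.indicator
          (fun ω' => W a ω' * (((fl (halfSpace 3) 0 a ω' : ℕ∞) : ℝ≥0∞))⁻¹) ω) a =
      (((fl (halfSpace 3) 0 0 ω : ℕ∞) : ℝ≥0∞))⁻¹ *
        ∑' a, (cl (halfSpace 3) 0 ω ∩ {u | u 0 = 0}).indicator (fun a => W a ω) a := by
  rw [← ENNReal.tsum_mul_left]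
  refine tsum_congr fun a => ?_
  by_cases ha0 : a 0 = 0
  · rw [Set.indicator_of_mem (show a ∈ {a : Site 3 | a 0 = 0} from ha0)]
    by_cases ha : (0 : Site 3) ∈ cl (halfSpace 3) a ω
    · have haU : a ∈ cl (halfSpace 3) 0 ω := conn_symm ha
      rw [Set.indicator_of_mem (show ω ∈ {ω' : BondConfig (Site 3) | a 0 = 0 ∧ (0 : Site 3) 0 = 0 ∧
          0 ∈ cl (halfSpace 3) a ω'} from ⟨ha0, rfl, ha⟩), Set.indicator_of_mem (show a ∈ cl (halfSpace 3) 0 ω ∩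
          {u | u 0 = 0} from ⟨haU, ha0⟩), fl_eq_of_mem haU, mul_comm]
    · rw [Set.indicator_of_notMem (show ω ∉ {ω' : BondConfig (Site 3) | a 0 = 0 ∧ (0 : Site 3) 0 = 0 ∧
          0 ∈ cl (halfSpace 3) a ω'} from fun h => ha h.2.2), Set.indicator_of_notMem (show a ∉ cl (halfSpace 3) 0 ω ∩
          {u | u 0 = 0} from fun h => ha (conn_symm h.1)), mul_zero]
  · rw [Set.indicator_of_notMem (show a ∉ {a : Site 3 | a 0 = 0} from ha0),
      Set.indicator_of_notMem (show a ∉ cl (halfSpace 3) 0 ω ∩ {u | u 0 = 0} from fun h => ha0 h.2), mul_zero]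

/-- **The root transport of a weight**: for a measurable, horizontally covariant weight `W`,
`∫ W(0) dP = ∫ |U ∩ ∂ℍ|⁻¹ Σ_{a ∈ U ∩ ∂ℍ} W(a) dP` — the floor mass-transport principle `stub_census_floorMTP`
applied to the root transport of `W` (on the BGN event `1 ≤ |U ∩ ∂ℍ| < ∞`). -/
theorem lintegral_rootTransport (W : Site 3 → BondConfig (Site 3) → ℝ≥0∞) (hmeas : ∀ a, Measurable (W a))
    (hW : ∀ (ω : BondConfig (Site 3)) (a v : Site 3), v 0 = 0 →
      W (a + v) (BondConfig.relabel (sym2Equiv (Site.shift v)) ω) = W a ω) :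
    ∫⁻ ω, W 0 ω ∂μ = ∫⁻ ω, (((fl (halfSpace 3) 0 0 ω : ℕ∞) : ℝ≥0∞))⁻¹ *
      ∑' a, (cl (halfSpace 3) 0 ω ∩ {u | u 0 = 0}).indicator (fun a => W a ω) a ∂μ := by
  have hT := stub_census_floorMTP (criticalProbI 3)
    (fun ω a b => {ω' : BondConfig (Site 3) | a 0 = 0 ∧ b 0 = 0 ∧ b ∈ cl (halfSpace 3) a ω'}.indicator
      (fun ω' => W a ω' * (((fl (halfSpace 3) 0 a ω' : ℕ∞) : ℝ≥0∞))⁻¹) ω)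
    (measurable_rootTransport W hmeas) (fun ω a b v hv => rootTransport_shift W hW ω a b v hv)
  calc ∫⁻ ω, W 0 ω ∂μ
      = ∫⁻ ω, ∑' b, {b : Site 3 | b 0 = 0}.indicator (fun b => {ω' : BondConfig (Site 3) | (0 : Site 3) 0 = 0 ∧
          b 0 = 0 ∧ b ∈ cl (halfSpace 3) 0 ω'}.indicator
            (fun ω' => W 0 ω' * (((fl (halfSpace 3) 0 0 ω' : ℕ∞) : ℝ≥0∞))⁻¹) ω) b ∂μ := by
        refine lintegral_congr_ae ?_
        filter_upwards [ae_good] with ω hω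
        rw [tsum_rootTransport_left]
        have h0 : ((fl (halfSpace 3) 0 0 ω : ℕ∞) : ℝ≥0∞) ≠ 0 := (lt_of_lt_of_le zero_lt_one (one_le_fl rfl ω)).ne'
        have htop : ((fl (halfSpace 3) 0 0 ω : ℕ∞) : ℝ≥0∞) ≠ ⊤ := ENat.toENNReal_ne_top.2
          ((finite_cl_halfSpace hω.2 rfl).subset Set.inter_subset_left).encard_lt_top.ne
        rw [ENNReal.inv_mul_cancel h0 htop, mul_one]
    _ = ∫⁻ ω, ∑' a, {a : Site 3 | a 0 = 0}.indicator (fun a => {ω' : BondConfig (Site 3) | a 0 = 0 ∧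
          (0 : Site 3) 0 = 0 ∧ (0 : Site 3) ∈ cl (halfSpace 3) a ω'}.indicator
            (fun ω' => W a ω' * (((fl (halfSpace 3) 0 a ω' : ℕ∞) : ℝ≥0∞))⁻¹) ω) a ∂μ := hT
    _ = _ := lintegral_congr fun ω => tsum_rootTransport_right W ω

/-! ### The inverse-multiplicity weight `ψ(a) = 1{C_ℍ(a) n-tall} · #(PK-edges at a) · |PK|⁻¹` -/

/-- The inverse-multiplicity weight is measurable. -/
theorem measurable_invMultWeight (n : ℕ) (a : Site 3) : Measurable fun ω : BondConfig (Site 3) =>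
    (tall (halfSpace 3) n a).indicator (fun ω' => (((Prod.mk a ⁻¹' PK n a ω').encard : ℕ∞) : ℝ≥0∞) *
      ((((PK n a ω').encard : ℕ∞) : ℝ≥0∞))⁻¹) ω := by
  refine Measurable.indicator (Measurable.mul ?_ ?_) (measurableSet_tall _ _ _)
  · exact (Measurable.of_discrete (f := fun m : ℕ∞ => (m : ℝ≥0∞))).comp (measurable_encard.comp
      (measurable_set_iff.2 fun q => measurableSet_setOf.1 (measurableSet_mem_PK n a (a, q))))
  · exact ((Measurable.of_discrete (f := fun m : ℕ∞ => (m : ℝ≥0∞))).comp (measurable_encard.comp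
      (measurable_PK n a))).inv

/-- Covariance of the inverse-multiplicity weight under horizontal shifts (the fibre at the root is shifted,
the total count `|PK|` is invariant). -/
theorem invMultWeight_shift (n : ℕ) (ω : BondConfig (Site 3)) (a v : Site 3) (hv : v 0 = 0) :
    (tall (halfSpace 3) n (a + v)).indicator (fun ω' => (((Prod.mk (a + v) ⁻¹' PK n (a + v) ω').encard : ℕ∞) : ℝ≥0∞) *
      ((((PK n (a + v) ω').encard : ℕ∞) : ℝ≥0∞))⁻¹) (BondConfig.relabel (sym2Equiv (Site.shift v)) ω) =
    (tall (halfSpace 3) n a).indicator (fun ω' => (((Prod.mk a ⁻¹' PK n a ω').encard : ℕ∞) : ℝ≥0∞) *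
      ((((PK n a ω').encard : ℕ∞) : ℝ≥0∞))⁻¹) ω := by
  have hfib : Prod.mk (a + v) ⁻¹' PK n (a + v) (BondConfig.relabel (sym2Equiv (Site.shift v)) ω) =
      (· + v) '' (Prod.mk a ⁻¹' PK n a ω) := by
    ext q
    simp only [Set.mem_preimage, Set.mem_image]
    constructor
    · intro h
      refine ⟨q - v, ?_, sub_add_cancel q v⟩
      have := (mem_PK_shift_iff hv n a ω (a, q - v)).1
      simp only [sub_add_cancel] at this
      exact this h
    · rintro ⟨w, hw, rfl⟩
      exact (mem_PK_shift_iff hv n a ω (a, w)).2 hw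
  have ht := tall_shift_iff hv (add_mem_halfSpace_iff hv) n a ω
  by_cases h : ω ∈ tall (halfSpace 3) n a
  · rw [Set.indicator_of_mem (ht.2 h), Set.indicator_of_mem h, hfib, (add_left_injective v).injOn.encard_image,
      PK_shift hv, (pairShift_injective v).injOn.encard_image]
  · rw [Set.indicator_of_notMem (fun h' => h (ht.1 h')), Set.indicator_of_notMem h]

/-- **In-mass of the inverse-multiplicity weight**: by root invariance of tallness and of `PK`,
`Σ_{a ∈ U ∩ ∂ℍ} ψ(a) = 1{U n-tall} |PK| |PK|⁻¹ ≤ 1{U n-tall, PK ≠ ∅}`. -/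
theorem tsum_invMultWeight_le (n : ℕ) (ω : BondConfig (Site 3)) :
    ∑' a, (cl (halfSpace 3) 0 ω ∩ {u | u 0 = 0}).indicator (fun a => (tall (halfSpace 3) n a).indicator
      (fun ω' => (((Prod.mk a ⁻¹' PK n a ω').encard : ℕ∞) : ℝ≥0∞) * ((((PK n a ω').encard : ℕ∞) : ℝ≥0∞))⁻¹) ω) a ≤
    {ω : BondConfig (Site 3) | ω ∈ tall (halfSpace 3) n 0 ∧ (PK n 0 ω).Nonempty}.indicator (fun _ => (1 : ℝ≥0∞)) ω := by
  have hterm : ∀ a, (cl (halfSpace 3) 0 ω ∩ {u | u 0 = 0}).indicator (fun a => (tall (halfSpace 3) n a).indicator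
      (fun ω' => (((Prod.mk a ⁻¹' PK n a ω').encard : ℕ∞) : ℝ≥0∞) * ((((PK n a ω').encard : ℕ∞) : ℝ≥0∞))⁻¹) ω) a =
      (tall (halfSpace 3) n 0).indicator (fun ω' => (((Prod.mk a ⁻¹' PK n 0 ω').encard : ℕ∞) : ℝ≥0∞) *
        ((((PK n 0 ω').encard : ℕ∞) : ℝ≥0∞))⁻¹) ω := by
    intro a
    by_cases ha : a ∈ cl (halfSpace 3) 0 ω ∩ {u | u 0 = 0}
    · rw [Set.indicator_of_mem ha]
      have haU : a ∈ cl (halfSpace 3) 0 ω := ha.1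
      by_cases ht : ω ∈ tall (halfSpace 3) n 0
      · rw [Set.indicator_of_mem ((tall_iff_of_mem haU).2 ht), Set.indicator_of_mem ht, PK_eq_of_mem haU]
      · rw [Set.indicator_of_notMem (fun h => ht ((tall_iff_of_mem haU).1 h)), Set.indicator_of_notMem ht]
    · rw [Set.indicator_of_notMem ha]
      have hfib : Prod.mk a ⁻¹' PK n 0 ω = ∅ :=
        Set.eq_empty_iff_forall_notMem.2 fun q hq => ha ⟨hq.2.2.2.1, hq.1⟩
      symm
      by_cases ht : ω ∈ tall (halfSpace 3) n 0
      · rw [Set.indicator_of_mem ht, hfib, Set.encard_empty]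
        simp
      · exact Set.indicator_of_notMem ht _
  rw [tsum_congr hterm]
  by_cases ht : ω ∈ tall (halfSpace 3) n 0
  · simp only [Set.indicator_of_mem ht]
    rw [ENNReal.tsum_mul_right, ← encard_eq_tsum_fiber]
    by_cases hne : (PK n 0 ω).Nonempty
    · rw [Set.indicator_of_mem (show ω ∈ {ω : BondConfig (Site 3) | ω ∈ tall (halfSpace 3) n 0 ∧
        (PK n 0 ω).Nonempty} from ⟨ht, hne⟩)]
      exact ENNReal.mul_inv_le_one _
    · rw [Set.not_nonempty_iff_eq_empty.1 hne, Set.encard_empty]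
      simp
  · simp only [Set.indicator_of_notMem ht, tsum_zero]
    exact bot_le

/-- **The root transport of the inverse-multiplicity weight**: `∫ ψ(0) dP ≤ κ_n`. -/
theorem lintegral_invMultWeight_le_kap (n : ℕ) :
    ∫⁻ ω, (tall (halfSpace 3) n 0).indicator (fun ω' => (((Prod.mk (0 : Site 3) ⁻¹' PK n 0 ω').encard : ℕ∞) : ℝ≥0∞) *
      ((((PK n 0 ω').encard : ℕ∞) : ℝ≥0∞))⁻¹) ω ∂μ ≤ kap n := by
  have h := lintegral_rootTransport (fun a ω => (tall (halfSpace 3) n a).indicator (fun ω' =>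
      (((Prod.mk a ⁻¹' PK n a ω').encard : ℕ∞) : ℝ≥0∞) * ((((PK n a ω').encard : ℕ∞) : ℝ≥0∞))⁻¹) ω)
    (measurable_invMultWeight n) (invMultWeight_shift n)
  rw [h, kap]
  refine lintegral_mono fun ω => ?_
  refine (mul_le_mul' le_rfl (tsum_invMultWeight_le n ω)).trans ?_
  by_cases hm : ω ∈ {ω : BondConfig (Site 3) | ω ∈ tall (halfSpace 3) n 0 ∧ (PK n 0 ω).Nonempty}
  · rw [Set.indicator_of_mem hm, Set.indicator_of_mem hm, mul_one]
  · rw [Set.indicator_of_notMem hm, Set.indicator_of_notMem hm, mul_zero]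

/-- **`∫_{A_n} (max 1 K_n)⁻¹ dP ≤ κ_n`**: on `A_n` the floor edge `(0, e)` is a partner-kiss edge of `U` at the
root, and on the BGN event `PK` is finite, so `(max 1 K_n)⁻¹ = |PK|⁻¹ ≤ ψ(0)` almost everywhere. -/
theorem lintegral_invMult_le_kap (n : ℕ) :
    ∫⁻ ω, {ω : BondConfig (Site 3) | (∃ y : Site 3, (n : ℤ) ≤ y 0 ∧ ω ∈ openConnIn (halfSpace 3) 0 y) ∧
          (∃ y : Site 3, (n : ℤ) ≤ y 0 ∧ ω ∈ openConnIn (halfSpace 3) ((0 : Site 3) + Pi.single 1 1) y) ∧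
          ω ∉ openConnIn (halfSpace 3) 0 ((0 : Site 3) + Pi.single 1 1)}.indicator
        (fun ω => (((max 1 (PK n 0 ω).ncard : ℕ) : ℝ≥0∞))⁻¹) ω ∂μ ≤ kap n := by
  refine le_trans (lintegral_mono_ae ?_) (lintegral_invMultWeight_le_kap n)
  filter_upwards [ae_good] with ω hω
  by_cases hA : ω ∈ {ω : BondConfig (Site 3) | (∃ y : Site 3, (n : ℤ) ≤ y 0 ∧ ω ∈ openConnIn (halfSpace 3) 0 y) ∧
      (∃ y : Site 3, (n : ℤ) ≤ y 0 ∧ ω ∈ openConnIn (halfSpace 3) ((0 : Site 3) + Pi.single 1 1) y) ∧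
      ω ∉ openConnIn (halfSpace 3) 0 ((0 : Site 3) + Pi.single 1 1)}
  · rw [Set.indicator_of_mem hA]
    obtain ⟨ht0, hte, hne⟩ := hA
    have hPK : ((0 : Site 3), (0 : Site 3) + Pi.single 1 1) ∈ PK n 0 ω := by
      refine ⟨rfl, by simp, ?_, conn_refl ω (zero_mem_halfSpace 3), hne, hte⟩
      exact (zdGraph_adj_iff _ _).2 ⟨1, Or.inl rfl⟩
    have hfin : (PK n 0 ω).Finite := PK_finite hω.2 n
    have h1 : (1 : ℝ≥0∞) ≤ (((Prod.mk (0 : Site 3) ⁻¹' PK n 0 ω).encard : ℕ∞) : ℝ≥0∞) := by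
      rw [← ENat.toENNReal_one, ENat.toENNReal_le, Set.one_le_encard_iff_nonempty]
      exact ⟨(0 : Site 3) + Pi.single 1 1, hPK⟩
    have hK : ((max 1 (PK n 0 ω).ncard : ℕ) : ℝ≥0∞) = (((PK n 0 ω).encard : ℕ∞) : ℝ≥0∞) := by
      rw [max_eq_right ((Set.ncard_pos hfin).2 ⟨_, hPK⟩), ← hfin.cast_ncard_eq, ENat.toENNReal_coe]
    rw [Set.indicator_of_mem (show ω ∈ tall (halfSpace 3) n 0 from ht0), hK]
    calc ((((PK n 0 ω).encard : ℕ∞) : ℝ≥0∞))⁻¹ = 1 * ((((PK n 0 ω).encard : ℕ∞) : ℝ≥0∞))⁻¹ := (one_mul _).symm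
      _ ≤ _ := mul_le_mul' h1 le_rfl
  · rw [Set.indicator_of_notMem hA]
    exact bot_le

/-- **The inverse-multiplicity census in `ℝ≥0∞`**: `∫_{A_n} (max 1 K_n)⁻¹ dP ≤ 2 e_n / p_c³` (root transport of
the inverse-multiplicity weight, the staple `kap_le_X` and the level census `X_le_two_eD`). -/
theorem invMult_census (n : ℕ) :
    ∫⁻ ω, {ω : BondConfig (Site 3) | (∃ y : Site 3, (n : ℤ) ≤ y 0 ∧ ω ∈ openConnIn (halfSpace 3) 0 y) ∧
          (∃ y : Site 3, (n : ℤ) ≤ y 0 ∧ ω ∈ openConnIn (halfSpace 3) ((0 : Site 3) + Pi.single 1 1) y) ∧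
          ω ∉ openConnIn (halfSpace 3) 0 ((0 : Site 3) + Pi.single 1 1)}.indicator
        (fun ω => (((max 1 (PK n 0 ω).ncard : ℕ) : ℝ≥0∞))⁻¹) ω ∂μ ≤
      (2 * eD n) / ENNReal.ofReal ((criticalProbI 3 : ℝ) ^ 3) := by
  have hp : 0 < (criticalProbI 3 : ℝ) := by
    rw [coe_criticalProbI]
    exact (Grimmett1999_criticalProb_pos_lt_one_holds 3 (by norm_num)).1
  have hP3 : ENNReal.ofReal ((criticalProbI 3 : ℝ) ^ 3) ≠ 0 := (ENNReal.ofReal_pos.2 (pow_pos hp 3)).ne'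
  rw [ENNReal.le_div_iff_mul_le (Or.inl hP3) (Or.inl ENNReal.ofReal_ne_top)]
  calc _ ≤ kap n * ENNReal.ofReal ((criticalProbI 3 : ℝ) ^ 3) := mul_le_mul' (lintegral_invMult_le_kap n) le_rfl
    _ = ENNReal.ofReal ((criticalProbI 3 : ℝ) ^ 3) * kap n := mul_comm _ _
    _ ≤ 2 * eD n := (kap_le_X n).trans (X_le_two_eD n)

end StubCensus

/-- **Registered stub `stub_inverseMultiplicityCensus`** of the skeleton
`Cruxes/BoundaryTwoArmDecay/Lines/staircase_bootstrap_floor_decoupling.lean` (line `staircase-bootstrap-floor-decoupling`):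
the INVERSE-MULTIPLICITY CENSUS at `p_c(ℤ³)` on the half-space `ℍ = {0 ≤ x₀}`,
`∫_{A_n} (max 1 K_n)⁻¹ dP ≤ 2 e_n / p_c³` for all `n`, where `A_n = {U n-tall, C_ℍ(e) n-tall, 0 ↮_ℍ e}`,
`K_n` is the number of partner-kiss edges of `U = C_ℍ(0)` and `e_n = E[1{height U = n}/|U ∩ ∂ℍ|]` — the truncated
level census `P(A_n ∩ {K_n ≤ k}) ≤ 2 k e_n / p_c³` with the truncation replaced by the weight `1/K_n`. Proof: the
root transport of the inverse-multiplicity weight (`StubCensus.lintegral_invMult_le_kap`: `∫_{A_n} (max 1 K_n)⁻¹ ≤ κ_n`),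
the staple (`StubCensus.kap_le_X`: `p_c³ κ_n ≤ X_n`) and the level census (`StubCensus.X_le_two_eD`: `X_n ≤ 2 e_n`). -/
theorem stub_inverseMultiplicityCensus : ∀ n : ℕ,
    (∫⁻ ω, {ω : BondConfig (Site 3) | (∃ y : Site 3, (n : ℤ) ≤ y 0 ∧ ω ∈ openConnIn (halfSpace 3) 0 y) ∧
          (∃ y : Site 3, (n : ℤ) ≤ y 0 ∧ ω ∈ openConnIn (halfSpace 3) ((0 : Site 3) + Pi.single 1 1) y) ∧
          ω ∉ openConnIn (halfSpace 3) 0 ((0 : Site 3) + Pi.single 1 1)}.indicator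
        (fun ω => (((max 1 {q : Site 3 × Site 3 | q.1 0 = 0 ∧ q.2 0 = 0 ∧ (zdGraph 3).Adj q.1 q.2 ∧
            ω ∈ openConnIn (halfSpace 3) 0 q.1 ∧ ω ∉ openConnIn (halfSpace 3) 0 q.2 ∧
            ∃ y : Site 3, (n : ℤ) ≤ y 0 ∧ ω ∈ openConnIn (halfSpace 3) q.2 y}.ncard : ℕ) : ENNReal))⁻¹) ω
        ∂(bondPercolation (zdGraph 3) (criticalProbI 3))) ≤
      (2 * ∫⁻ ω, {ω | (∃ y : Site 3, (n : ℤ) ≤ y 0 ∧ ω ∈ openConnIn (halfSpace 3) 0 y) ∧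
            ¬ (∃ y : Site 3, ((n + 1 : ℕ) : ℤ) ≤ y 0 ∧ ω ∈ openConnIn (halfSpace 3) 0 y)}.indicator
          (fun ω => (((halfSpaceFootprint ω : ℕ∞) : ENNReal))⁻¹) ω
          ∂(bondPercolation (zdGraph 3) (criticalProbI 3))) / ENNReal.ofReal ((criticalProbI 3 : ℝ) ^ 3) :=
  fun n => StubCensus.invMult_census n

end Summit.CriticalPhenomena.PercolationContinuityZ3.Theorems.BoundaryTwoArmDecay

end
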